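import Summits.QuantumFields.YangMills.Theorems.ColdStartUniversalityLatticeLangevinLatitudeAlgebra
import HarnessLib

/-!
# Route `ColdStartUniversality`, crux K_A1 `UniformColdStartMixing` (stmt-QuantumFields-24809), rung `stub_fixedCutoffMixing`:
# G-block, brick G1b (matrix core) — towards SZZ Lemma 3.1: the Langevin drift is the frame expansion of the plaquette derivative

Helper file (seat `ym-line-csu-p1`, g7).  Ingredients of the gradient formula `(driftLie β Q e) Q_e = ½ Σ_n Dψ[σ_{e,n}] σ_{e,n}`:
* `sum_hsForm_lieProj_smul` — Parseval through the projection: `Σ_n ⟨X, 𝐩 E_n⟩ 𝐩 E_n = 𝐩 X`;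
* `hsForm_conjTranspose_left` — `⟨Rᴴ, A⟩ = Re tr(A R)`; `driftLie_eq_sum_lieProj_noiseDir` — the drift as the frame expansion
  `driftLie β Q e = Σ_n (β Σ_{j ≠ e.2, b} Re tr(𝐩(E_n) · rootedLoop Q e j b)) • 𝐩(E_n)`;
* trace identities for the slots of a plaquette word in which the differentiated link enters reversed
  (`re_trace_mul_conjTranspose_of_skew`, `re_trace_mul_conjTranspose_mul_of_skew`);
* an instance-free (entrywise) differential calculus for matrix-valued paths `s ↦ M(s)`: products, conjugate transposes,
  `Re tr`, affine paths (`hasDerivAt_entry_mul`, `hasDerivAt_entry_conjTranspose`, `hasDerivAt_re_trace`, `hasDerivAt_entry_affine`),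
  and the derivative of `Re tr` of a plaquette word along the perturbation `Q ↦ Q + s δ_e(A Q_e)` as the sum over its four slots
  (`hasDerivAt_re_trace_rootedLoop_false`).
No definition, no sorry.  RECORD-rung R3 plumbing; nothing here bears on the mass gap.
-/

set_option autoImplicit false

noncomputable section

namespace Summit.QuantumFields.YangMills.Theorems.ColdStartUniversality

open Finset Matrix Complex
open scoped BigOperators Matrix ComplexConjugate
open Literature.MathematicalPhysics.QuantumFieldTheory

/-! ### Parseval through the projection; the drift as a frame expansion -/

section Frame

variable {G : Type*} [Group G] [TopologicalSpace G] (r : LatticeRep G)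

/-- **Parseval through `𝐩`**: `Σ_n ⟨X, 𝐩 E_n⟩ 𝐩 E_n = 𝐩 X`. [folklore] -/
theorem sum_hsForm_lieProj_smul (X : Matrix (Fin r.N) (Fin r.N) ℂ) :
    ∑ n : NoiseIdx r.N, hsForm r.N X (r.lieProj (noiseDir n)) • r.lieProj (noiseDir n) = r.lieProj (r.lieProj X) := by
  conv_rhs => rw [← sum_hsForm_noiseDir_smul (r.lieProj X), map_sum]
  refine Finset.sum_congr rfl fun n _ => ?_
  rw [map_smul, ← hsForm_lieProj_comm]

/-- `𝐩 (𝐩 X) = 𝐩 X`. [folklore] -/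
theorem lieProj_lieProj (X : Matrix (Fin r.N) (Fin r.N) ℂ) : r.lieProj (r.lieProj X) = r.lieProj X :=
  r.lieProj_of_mem (r.lieProj_mem X)

/-- `⟨Rᴴ, A⟩ = Re tr(A R)`. [folklore] -/
theorem hsForm_conjTranspose_left {N : ℕ} (R A : Matrix (Fin N) (Fin N) ℂ) :
    hsForm N Rᴴ A = (A * R).trace.re := by
  rw [hsForm_apply, ← Matrix.conjTranspose_mul, Matrix.trace_conjTranspose]
  exact Complex.conj_re _

/-- **The Langevin drift as a frame expansion** (the algebraic half of SZZ Lemma 3.1):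
`driftLie β Q e = Σ_n (β Σ_{j ≠ e.2} Σ_b Re tr(𝐩(E_n) · rootedLoop Q e j b)) • 𝐩(E_n)`. [cite: ShenZhuZhu2022, §3 Lemma 3.1] -/
theorem driftLie_eq_sum_lieProj_noiseDir {d L : ℕ} (β : ℝ) (Q : MatrixConfig d L r.N) (e : Edge d L) :
    r.driftLie β Q e = ∑ n : NoiseIdx r.N,
      (β * ∑ j ∈ univ.erase e.2, ∑ b : Bool, (r.lieProj (noiseDir n) * rootedLoop Q e j b).trace.re) •
        r.lieProj (noiseDir n) := by
  have hexp : ∀ R : Matrix (Fin r.N) (Fin r.N) ℂ, r.lieProj Rᴴ =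
      ∑ n : NoiseIdx r.N, (r.lieProj (noiseDir n) * R).trace.re • r.lieProj (noiseDir n) := by
    intro R
    rw [← lieProj_lieProj, ← sum_hsForm_lieProj_smul]
    refine Finset.sum_congr rfl fun n _ => ?_
    rw [hsForm_conjTranspose_left]
  unfold LatticeRep.driftLie
  simp_rw [hexp]
  rw [Finset.smul_sum]
  simp_rw [Finset.smul_sum, Finset.mul_sum, Finset.sum_smul, smul_smul]
  symm
  rw [Finset.sum_comm]
  exact Finset.sum_congr rfl fun j _ => Finset.sum_comm

end Frame

/-! ### Trace identities for reversed slots -/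

/-- For skew-Hermitian `A`: `Re tr(A Mᴴ) = -Re tr(A M)`. [folklore] -/
theorem re_trace_mul_conjTranspose_of_skew {N : ℕ} {A : Matrix (Fin N) (Fin N) ℂ} (hA : Aᴴ = -A)
    (M : Matrix (Fin N) (Fin N) ℂ) : (A * Mᴴ).trace.re = -(A * M).trace.re := by
  calc (A * Mᴴ).trace.re = ((A * Mᴴ)ᴴ).trace.re := by rw [Matrix.trace_conjTranspose]; exact (Complex.conj_re _).symm
    _ = (M * Aᴴ).trace.re := by rw [Matrix.conjTranspose_mul, Matrix.conjTranspose_conjTranspose]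
    _ = -(A * M).trace.re := by rw [hA, Matrix.mul_neg, Matrix.trace_neg, Complex.neg_re, Matrix.trace_mul_comm]

/-- **Reversed slot** (skew-Hermitian `A`): `Re tr(B (A Y)ᴴ C) = Re tr(A · Y Bᴴ Cᴴ)`. [folklore] -/
theorem re_trace_mul_conjTranspose_mul_of_skew {N : ℕ} {A : Matrix (Fin N) (Fin N) ℂ} (hA : Aᴴ = -A)
    (B Y C : Matrix (Fin N) (Fin N) ℂ) : (B * (A * Y)ᴴ * C).trace.re = (A * (Y * Bᴴ * Cᴴ)).trace.re := by
  have h1 : B * (A * Y)ᴴ * C = -(B * Yᴴ * A * C) := by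
    rw [Matrix.conjTranspose_mul, hA]
    simp only [Matrix.mul_neg, Matrix.neg_mul, Matrix.mul_assoc]
  have h2 : (B * Yᴴ * A * C).trace = (A * (C * B * Yᴴ)).trace := by
    rw [Matrix.trace_mul_cycle (B * Yᴴ) A C, Matrix.trace_mul_comm _ A]
    simp only [Matrix.mul_assoc]
  rw [h1, Matrix.trace_neg, Complex.neg_re, h2, ← re_trace_mul_conjTranspose_of_skew hA]
  simp only [Matrix.conjTranspose_mul, Matrix.conjTranspose_conjTranspose, Matrix.mul_assoc]

/-- **Last slot reversed** (skew-Hermitian `A`): `Re tr(B (A Y)ᴴ) = Re tr(A · Y Bᴴ)`. [folklore] -/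
theorem re_trace_mul_conjTranspose_of_skew' {N : ℕ} {A : Matrix (Fin N) (Fin N) ℂ} (hA : Aᴴ = -A)
    (B Y : Matrix (Fin N) (Fin N) ℂ) : (B * (A * Y)ᴴ).trace.re = (A * (Y * Bᴴ)).trace.re := by
  have h := re_trace_mul_conjTranspose_mul_of_skew hA B Y 1
  rwa [Matrix.mul_one, Matrix.conjTranspose_one, Matrix.mul_one] at h

/-- **Forward inner slot**: `Re tr(B (A Y) C) = Re tr(A · Y C B)` (cyclicity). [folklore] -/
theorem re_trace_mul_mul_mul_cycle {N : ℕ} (A B Y C : Matrix (Fin N) (Fin N) ℂ) :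
    (B * (A * Y) * C).trace.re = (A * (Y * C * B)).trace.re := by
  rw [Matrix.trace_mul_cycle B (A * Y) C, Matrix.trace_mul_comm (C * B), Matrix.mul_assoc A, ← Matrix.mul_assoc Y]

/-! ### Entrywise calculus for matrix-valued paths (no norm on matrices needed) -/

/-- Product rule, entrywise. [folklore] -/
theorem hasDerivAt_entry_mul {N : ℕ} {M P : ℝ → Matrix (Fin N) (Fin N) ℂ} {M₁ P₁ : Matrix (Fin N) (Fin N) ℂ} {s₀ : ℝ}
    (hM : ∀ a b, HasDerivAt (fun s => M s a b) (M₁ a b) s₀) (hP : ∀ a b, HasDerivAt (fun s => P s a b) (P₁ a b) s₀)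
    (a b : Fin N) : HasDerivAt (fun s => (M s * P s) a b) ((M₁ * P s₀ + M s₀ * P₁) a b) s₀ := by
  simp only [Matrix.mul_apply, Matrix.add_apply]
  rw [← Finset.sum_add_distrib]
  exact HasDerivAt.fun_sum fun c _ => (hM a c).mul (hP c b)

/-- Conjugate transpose, entrywise. [folklore] -/
theorem hasDerivAt_entry_conjTranspose {N : ℕ} {M : ℝ → Matrix (Fin N) (Fin N) ℂ} {M₁ : Matrix (Fin N) (Fin N) ℂ}
    {s₀ : ℝ} (hM : ∀ a b, HasDerivAt (fun s => M s a b) (M₁ a b) s₀) (a b : Fin N) :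
    HasDerivAt (fun s => (M s)ᴴ a b) (M₁ᴴ a b) s₀ := by
  simp only [Matrix.conjTranspose_apply]
  exact (hM b a).star

/-- `Re tr`, from entrywise derivatives. [folklore] -/
theorem hasDerivAt_re_trace {N : ℕ} {M : ℝ → Matrix (Fin N) (Fin N) ℂ} {M₁ : Matrix (Fin N) (Fin N) ℂ} {s₀ : ℝ}
    (hM : ∀ a b, HasDerivAt (fun s => M s a b) (M₁ a b) s₀) :
    HasDerivAt (fun s => (M s).trace.re) M₁.trace.re s₀ := by
  have h1 : HasDerivAt (fun s => (M s).trace) M₁.trace s₀ := by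
    simp only [Matrix.trace, Matrix.diag]
    exact HasDerivAt.fun_sum fun i _ => hM i i
  exact Complex.reCLM.hasFDerivAt.comp_hasDerivAt s₀ h1

/-- Affine paths `s ↦ F + s G`, entrywise. [folklore] -/
theorem hasDerivAt_entry_affine {N : ℕ} (F G : Matrix (Fin N) (Fin N) ℂ) (s₀ : ℝ) (a b : Fin N) :
    HasDerivAt (fun s : ℝ => (F + (s : ℂ) • G) a b) (G a b) s₀ := by
  simp only [Matrix.add_apply, Matrix.smul_apply, smul_eq_mul]
  have h : HasDerivAt (fun s : ℝ => (s : ℂ)) 1 s₀ := by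
    simpa using (hasDerivAt_id s₀).ofReal_comp
  have h2 := (h.mul_const (G a b)).const_add (F a b)
  simpa using h2

/-- **Derivative of a plaquette word along a perturbation of the links**: for the path `Q^s = Q + s D`,
`d/ds|₀ Re tr(rootedLoop Q^s e j false)` is the sum over the four slots of the word with that slot's link replaced by
`D` (reversed slots: `Dᴴ`). [folklore] -/
theorem hasDerivAt_re_trace_rootedLoop_false {d L N : ℕ} (Q D : MatrixConfig d L N) (e : Edge d L) (j : Fin d) :
    HasDerivAt (fun s : ℝ => (rootedLoop (fun e' => Q e' + (s : ℂ) • D e') e j false).trace.re)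
      ((D e * Q (e.1.shift e.2, j) * (Q (e.1.shift j, e.2))ᴴ * (Q (e.1, j))ᴴ).trace.re +
        (Q e * D (e.1.shift e.2, j) * (Q (e.1.shift j, e.2))ᴴ * (Q (e.1, j))ᴴ).trace.re +
        (Q e * Q (e.1.shift e.2, j) * (D (e.1.shift j, e.2))ᴴ * (Q (e.1, j))ᴴ).trace.re +
        (Q e * Q (e.1.shift e.2, j) * (Q (e.1.shift j, e.2))ᴴ * (D (e.1, j))ᴴ).trace.re) 0 := by
  simp only [rootedLoop]
  have hF : ∀ e' : Edge d L, ∀ a b, HasDerivAt (fun s : ℝ => (Q e' + (s : ℂ) • D e') a b) (D e' a b) 0 :=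
    fun e' a b => hasDerivAt_entry_affine (Q e') (D e') 0 a b
  have h0 : ∀ e' : Edge d L, Q e' + ((0 : ℝ) : ℂ) • D e' = Q e' := fun e' => by
    rw [Complex.ofReal_zero, zero_smul, add_zero]
  have h12 := hasDerivAt_entry_mul (hF e) (hF (e.1.shift e.2, j))
  have h123 := hasDerivAt_entry_mul h12 (hasDerivAt_entry_conjTranspose (hF (e.1.shift j, e.2)))
  have h1234 := hasDerivAt_entry_mul h123 (hasDerivAt_entry_conjTranspose (hF (e.1, j)))
  have h := hasDerivAt_re_trace h1234
  simp only [h0] at h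
  convert h using 1
  simp only [Matrix.add_mul, Matrix.trace_add, Complex.add_re]

end Summit.QuantumFields.YangMills.Theorems.ColdStartUniversality

end
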